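import Summits.QuantumFields.YangMills.Theorems.BalabanUVNodesN11Sect3SupplyChainBorelBThm1Printed
import Summits.QuantumFields.YangMills.Theorems.BalabanUVNodesN11Sect3SupplyChainZero

/-!
# DAG node N11 — BOREL 𝐁-TERMS ALONG THE WITNESS CHAIN, IV: the A2 companions — `SupplierBorel` IS INHABITED (the zero supplier, outright), and in THE ALL-𝐓-ABSENT WORLD
# (no 𝐓-present expansion child in any windowed run) N11's PRINTED OUTPUT `B16.Thm1Printed` at the CoPH ∕ K1⁷-keyed datum of a Gaussian certificate holds from the
# datum's key and the live line ALONE — there the supplier-side rows of III's ★★★★★ are MET by the zero supplier and the reading-line rows are not needed at all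
# (dag-n11-e's operand-rows road: def-T's operand rows hold outright along the zero chain)

HEADER — WORK-UNIT METADATA.  Cell `pub-ymgap`, YM-PLAN Track A (D-0062 ∕ D-0149 width seats), seat `pub-ymgap-dag-n11-w1` (g0; WIDTH SEAT 1 of 4 on NODE n11 [B14]),
route `BalabanUVNodes` rev 25, item K1⁷ `StabilityBAtRecordR13SepCoPH` = stmt-QuantumFields-20542 (helper, `--kind proof --supports 20542 --as helper`, count-neutral).
[III] = [Balaban1988Convergent], [B16] = [Balaban1989LargeFieldII].  Over this seat's `…N11Sect3SupplyChainBorelB` (`SupplierBorel`) ∕ `…BorelBThm1Printed` (the printed faces)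
and dag-n11-e's `…N11Sect3SupplyChainZero` (`zeroSupplier`, `supplierObligations_zeroSupplier_of_forall_absent`, `operandRowsAlongChain_zeroSupplier`, `isFluctLocal_zero`),
`…ObligationsDefs` (`noExpansionObligation_of_gaussCert_of_operandRows`), `…SupplyChainNode` (`thm1Printed_datumOfRecord₁₃CoPH_of_obligations`).

WHAT THIS FILE PROVES (5 theorems, 0 `sorry`, 0 `def`; nothing of Bałaban asserted).
§1 ★ `supplierBorel_zeroSupplier`: `SupplierBorel θ p (zeroSupplier θ p)` OUTRIGHT (A2: the predicate displayed by III's faces is inhabited, and not ex falso).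
§2 ★★ `thm1Printed_datumOfRecord₁₃CoPH_of_forall_absent_of_gaussCert`: at any Gaussian-class `θ` on the live-selector line, if along every run in a window `]0, γ]` every
   expansion child is 𝐓-ABSENT (`Ω_{k+1}(s) ≠ ∅ → slotsT_{k+1}(s) = 0`), then `B16.Thm1Printed (datumOfRecord₁₃CoPH F N θ h).C` — from the core provisos and the live line,
   NO reading-line row, NO supplier (the zero supplier meets `SupplierObligations`, def-T's operand rows hold outright along its chain, and the no-expansion obligation is
   dag-n11-e's `noExpansionObligation_of_gaussCert_of_operandRows`); ★★ `…_gaussPinH_of_forall_absent` (named certificate); ★★★ `thm1Printed_datumOfRecord₁₃CoPH_gaussPinH_theta13LiveOfRecordH_of_forall_absent`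
   ∕ ★★★ `thm1Printed_datumOfRecord₁₃SepCoPH_gaussPinH_theta13LiveOfRecordH_of_forall_absent` (at the certificate of any H-extension of the witness of record, CoPH and K1⁷-keyed
   SepCoPH datum: from `hrec` (+ a separated-range key `hG`) and the absence hypothesis — NOTHING ELSE).  dag-n11-e proved the `SLaw` forms (`sLaw₁₃CoPH_all_of_forall_absent_of_gaussCert`,
   `…_gaussCertH_theta13LiveOfRecord_of_forall_absent`); these are the PRINTED forms per windowed run.

HONEST FRAMING.  Helper lane of K1⁷; kernel bookkeeping; nothing of Bałaban asserted.  The all-𝐓-absent world is a DEGENERATE regime (consistency evidence for the displayed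
rows of III, not a discharge of [III] §3): N11 NOT discharged; K1⁷ NOT closed; counts unmoved (typed 28∕28 · discharged 5∕27).  R4 closes only the conditional finite-𝕋⁴ rung
`BalabanLadder.UV` of one programme at fixed `ε = L^{−K}` — NOT ℝ⁴, NOT OS, NOT a mass gap, NOT Clay.  No `sorry`, `axiom`, `instance`, `notation`.
Sources (SHAPE only): [III] Thm 1 p.262, Theorem p.245, §3 p.279, (3.24)–(3.25) p.270, (0.2) p.244; [B16] Thm 1 p.355.
-/

noncomputable section

open MeasureTheory
open scoped BigOperators ENNReal NNReal Matrix.Norms.L2Operator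

namespace Summit.QuantumFields.YangMills.Theorems.BalabanUVNodesN11Sect3SupplyChainBorelBZero

open Literature.MathematicalPhysics.QuantumFieldTheory.Balaban1983to89 T4Continuum Node00 Node00.Tk
open B15DeterminingSets B8Eq17ClassAkV1 Step
open B10Eq42TorusConstraint (bondsIn)
open BalabanUVNodesN11HistoryPinnedResidualDefs (ZhPinOfRecord₁₃)
open BalabanUVNodesN11Sect3SupplyChainDefs
open BalabanUVNodesN11Sect3SupplyChainBorelB (SupplierBorel)
open BalabanUVNodesN11Sect3SupplyChainObligationsDefs
open BalabanUVNodesN11Sect3SupplyChainNode (thm1Printed_datumOfRecord₁₃CoPH_of_obligations)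
open BalabanUVNodesN11Sect3SupplyChainZero (zeroSupplier supplierObligations_zeroSupplier_of_forall_absent operandRowsAlongChain_zeroSupplier isFluctLocal_zero)
open BalabanUVNodesN11Sect3SupplyChainBorelBThm1Printed (step_inInterval_of_flow_inInterval_min)
open BalabanUVNodesN11GaussianCertificateDefs (gaussPinH gaussPinH_ζ0 gaussPinH_quad provisos₁₃CoPH_gaussPinH)
open Literature.MathematicalPhysics.QuantumFieldTheory.Balaban1983to89.B16RLeafRecord13AtLive (kappa_nonneg_theta13LiveOfFamily B0_nonneg_theta13LiveOfFamily
  E0_nonneg_theta13LiveOfFamily)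

variable {F : T4Family} {N : ℕ} [NeZero N]

/-! ## §1  `SupplierBorel` is inhabited: the zero supplier -/

section Inhabited

variable (θ : Stage13HParams F N) (p : B12.RunParams)

/-- **★ THE ZERO SUPPLIER HAS JOINTLY BOREL BOUNDARY TERMS, OUTRIGHT** (its responses are the zero term values: constants).  A2 for III's faces: `SupplierBorel` is
inhabited at every `θ`, `p`, not ex falso. [cite: Balaban1988Convergent, Thm 1 p.262, §3 p.279 (bookkeeping)] -/
theorem supplierBorel_zeroSupplier : SupplierBorel θ p (zeroSupplier θ p) := fun _ _ _ _ _ => measurable_const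

end Inhabited

/-! ## §2  The all-𝐓-absent world, printed: `B16.Thm1Printed` at a Gaussian certificate from the datum's key and the live line alone -/

section Absent

variable (θ : Stage13HParams F N)

/-- **★★ N11's PRINTED OUTPUT IN THE ALL-𝐓-ABSENT WORLD AT ANY GAUSSIAN-CLASS `θ`**: if along every run in a window `]0, γ]` every expansion child is 𝐓-absent, then
`B16.Thm1Printed (datumOfRecord₁₃CoPH F N θ h).C` from the core provisos and the live-selector line — the zero supplier (dag-n11-e's `supplierObligations_zeroSupplier_of_forall_absent`,
`operandRowsAlongChain_zeroSupplier`, `noExpansionObligation_of_gaussCert_of_operandRows`) through `thm1Printed_datumOfRecord₁₃CoPH_of_obligations` in the printed window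
`]0, min γ θ.γ]` (`1 ≤ M`, `0 < θ.γ` read off admissibility).  NO reading-line row, NO supplier hypothesis.
[cite: Balaban1988Convergent, Thm 1 p.262, Theorem p.245, (3.24)–(3.25) p.270; Balaban1989LargeFieldII, Thm 1 p.355; Balaban1989LargeFieldI, (0.3)–(0.4) p.176, p.177 (i)–(ii)] -/
theorem thm1Printed_datumOfRecord₁₃CoPH_of_forall_absent_of_gaussCert
    (hζ : ∀ (p : B12.RunParams) (n : ℕ) (Ω Λ : ℕ → Set (Site (F.P p.K) 0)), (θ.Zh p n Ω Λ).ζ0 = (ZhPinOfRecord₁₃ θ.toStage13Params p Ω Λ).ζ0)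
    (hq : ∀ (p : B12.RunParams) (n : ℕ) (Ω Λ : ℕ → Set (Site (F.P p.K) 0)) (j : ℕ) (Λ' : Set (Site (F.P p.K) 0)) (ω : MultiCfg (F.P p.K) (SU N) (FluctV N)),
      (θ.Zh p n Ω Λ).quad j Λ' ω = ∑ b ∈ (Set.toFinite (bondsIn j (Λ'ᶜ ∩ Ω (j + 1)))).toFinset, ‖(ω j).2 b‖ ^ 2)
    (h : θ.Provisos₁₃CoPH F N) (hsel : θ.ppSel = ppSelLiveOfRecord F N θ.ν θ.τ9 (EOfRecord₁₃ F N θ.toStage13Params) (wOfRecord₉ F N θ.toStage9Params))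
    (hθ : θ.Admissible F N) (hκ : 0 ≤ θ.s2.lf.κ) (hE₀ : 0 ≤ θ.s2.lf.E₀) (hB₀ : 0 ≤ θ.s2.lf.B₀) {γ : ℝ} (hγ : 0 < γ)
    (habs : ∀ P : B12.RunParams, Step.InInterval γ P.K (gOfRecord₁₃ F N θ.toStage13Params P) → ∀ k, k < P.K →
      ∀ s : SeqOfRecord F θ.ν θ.τ9.M (gOfRecord₁₃ F N θ.toStage13Params P) P.K (k + 1), s.Ω (k + 1) ≠ ∅ →
        slotsTOfRecord F N θ.ν θ.τ9 (EOfRecord₁₃ F N θ.toStage13Params) (wOfRecord₉ F N θ.toStage9Params) θ.ppSel P (gOfRecord₁₃ F N θ.toStage13Params P) (k + 1) s = 0) :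
    B16.Thm1Printed (datumOfRecord₁₃CoPH F N θ h).C :=
  thm1Printed_datumOfRecord₁₃CoPH_of_obligations h hsel hθ hκ hE₀ hB₀ hθ.toStage9.2.2.2 (lt_min hγ hθ.toStage9.gamma_pos) (fun P => zeroSupplier θ P)
    (fun P hP => supplierObligations_zeroSupplier_of_forall_absent hE₀ (habs P (step_inInterval_of_flow_inInterval_min θ h hP).1)) fun P _ =>
    noExpansionObligation_of_gaussCert_of_operandRows hζ hq h hθ.toStage9.2.2.2 (zeroSupplier θ P) (fun k _ => isFluctLocal_zero (θ := θ) (p := P) (k + 1))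
      operandRowsAlongChain_zeroSupplier

/-- **★★ … AT THE NAMED CERTIFICATE `gaussPinH θ`** (no class hypothesis). [cite: Balaban1988Convergent, Thm 1 p.262, Theorem p.245, (3.24)–(3.25) p.270; Balaban1989LargeFieldII, Thm 1 p.355] -/
theorem thm1Printed_datumOfRecord₁₃CoPH_gaussPinH_of_forall_absent
    (h : θ.Provisos₁₃CoPH F N) (hsel : θ.ppSel = ppSelLiveOfRecord F N θ.ν θ.τ9 (EOfRecord₁₃ F N θ.toStage13Params) (wOfRecord₉ F N θ.toStage9Params))
    (hθ : θ.Admissible F N) (hκ : 0 ≤ θ.s2.lf.κ) (hE₀ : 0 ≤ θ.s2.lf.E₀) (hB₀ : 0 ≤ θ.s2.lf.B₀) {γ : ℝ} (hγ : 0 < γ)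
    (habs : ∀ P : B12.RunParams, Step.InInterval γ P.K (gOfRecord₁₃ F N θ.toStage13Params P) → ∀ k, k < P.K →
      ∀ s : SeqOfRecord F θ.ν θ.τ9.M (gOfRecord₁₃ F N θ.toStage13Params P) P.K (k + 1), s.Ω (k + 1) ≠ ∅ →
        slotsTOfRecord F N θ.ν θ.τ9 (EOfRecord₁₃ F N θ.toStage13Params) (wOfRecord₉ F N θ.toStage9Params) θ.ppSel P (gOfRecord₁₃ F N θ.toStage13Params P) (k + 1) s = 0) :
    B16.Thm1Printed (datumOfRecord₁₃CoPH F N (gaussPinH θ) (provisos₁₃CoPH_gaussPinH h)).C :=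
  thm1Printed_datumOfRecord₁₃CoPH_of_forall_absent_of_gaussCert (gaussPinH θ) (gaussPinH_ζ0 θ) (gaussPinH_quad θ) (provisos₁₃CoPH_gaussPinH h) hsel hθ hκ hE₀ hB₀ hγ habs

end Absent

section AbsentRecord

variable (F N)
variable {Zr : (q : B12.RunParams) → TkResidualW F N (FluctV N) q.K}
  {Zh : (q : B12.RunParams) → ℕ → (ℕ → Set (Site (F.P q.K) 0)) → (ℕ → Set (Site (F.P q.K) 0)) → TkResidualW F N (FluctV N) q.K}
  {Phih : (q : B12.RunParams) → ℕ → (ℕ → Set (Site (F.P q.K) 0)) → (ℕ → Set (Site (F.P q.K) 0)) → (ℕ → Plaq (F.P q.K) 0 → ℝ)}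

/-- **★★★ N11's PRINTED OUTPUT IN THE ALL-𝐓-ABSENT WORLD AT THE CERTIFICATE `gaussPinH ⟨⟨θ₁₃, Zr⟩, Zh, Phih⟩` OF ANY H-EXTENSION OF THE WITNESS OF RECORD — FROM `hrec` AND THE
ABSENCE HYPOTHESIS, NOTHING ELSE** (selector `rfl`, admissibility and signs the family's). [cite: Balaban1988Convergent, Thm 1 p.262, Theorem p.245, (3.24)–(3.25) p.270; Balaban1989LargeFieldII, Thm 1 p.355; Balaban1989LargeFieldI, (0.3)–(0.4) p.176] -/
theorem thm1Printed_datumOfRecord₁₃CoPH_gaussPinH_theta13LiveOfRecordH_of_forall_absent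
    (hrec : (⟨⟨theta13LiveOfRecord F N, Zr⟩, Zh, Phih⟩ : Stage13HParams F N).Provisos₁₃CoPH F N) {γ : ℝ} (hγ : 0 < γ)
    (habs : ∀ P : B12.RunParams, Step.InInterval γ P.K (gOfRecord₁₃ F N (theta13LiveOfRecord F N) P) → ∀ k, k < P.K →
      ∀ s : SeqOfRecord F (theta13LiveOfRecord F N).ν (theta13LiveOfRecord F N).τ9.M (gOfRecord₁₃ F N (theta13LiveOfRecord F N) P) P.K (k + 1), s.Ω (k + 1) ≠ ∅ →
        slotsTOfRecord F N (theta13LiveOfRecord F N).ν (theta13LiveOfRecord F N).τ9 (EOfRecord₁₃ F N (theta13LiveOfRecord F N)) (wOfRecord₉ F N (theta13LiveOfRecord F N).toStage9Params) (theta13LiveOfRecord F N).ppSel P (gOfRecord₁₃ F N (theta13LiveOfRecord F N) P) (k + 1) s = 0) :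
    B16.Thm1Printed (datumOfRecord₁₃CoPH F N (gaussPinH (⟨⟨theta13LiveOfRecord F N, Zr⟩, Zh, Phih⟩ : Stage13HParams F N)) (provisos₁₃CoPH_gaussPinH hrec)).C :=
  thm1Printed_datumOfRecord₁₃CoPH_gaussPinH_of_forall_absent (⟨⟨theta13LiveOfRecord F N, Zr⟩, Zh, Phih⟩ : Stage13HParams F N) hrec rfl (admissible_theta13LiveOfRecord F N)
    (kappa_nonneg_theta13LiveOfFamily F N eps0OfRecord₁₃ (zeta316OfRecord F N (numerics7OfFamily eps0OfRecord₁₃) 1 1) (RzOfRecord F N) (ZtOfRecord F N)) (E0_nonneg_theta13LiveOfFamily F N eps0OfRecord₁₃ (zeta316OfRecord F N (numerics7OfFamily eps0OfRecord₁₃) 1 1) (RzOfRecord F N) (ZtOfRecord F N))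
    (B0_nonneg_theta13LiveOfFamily F N eps0OfRecord₁₃ (zeta316OfRecord F N (numerics7OfFamily eps0OfRecord₁₃) 1 1) (RzOfRecord F N) (ZtOfRecord F N)) hγ habs

/-- **★★★ … AT THE K1⁷-KEYED DATUM `datumOfRecord₁₃SepCoPH`** of the certificate, for any separated-range key `hG` (def-T's `datumOfRecord₁₃SepCoPH_eq_coPH`, `rfl`).
[cite: Balaban1988Convergent, Thm 1 p.262, Theorem p.245, (0.2) p.244; Balaban1989LargeFieldII, Thm 1 p.355] -/
theorem thm1Printed_datumOfRecord₁₃SepCoPH_gaussPinH_theta13LiveOfRecordH_of_forall_absent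
    (hrec : (⟨⟨theta13LiveOfRecord F N, Zr⟩, Zh, Phih⟩ : Stage13HParams F N).Provisos₁₃CoPH F N) (hG : (gaussPinH (⟨⟨theta13LiveOfRecord F N, Zr⟩, Zh, Phih⟩ : Stage13HParams F N)).Provisos₁₃SepCoPH F N) {γ : ℝ} (hγ : 0 < γ)
    (habs : ∀ P : B12.RunParams, Step.InInterval γ P.K (gOfRecord₁₃ F N (theta13LiveOfRecord F N) P) → ∀ k, k < P.K →
      ∀ s : SeqOfRecord F (theta13LiveOfRecord F N).ν (theta13LiveOfRecord F N).τ9.M (gOfRecord₁₃ F N (theta13LiveOfRecord F N) P) P.K (k + 1), s.Ω (k + 1) ≠ ∅ →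
        slotsTOfRecord F N (theta13LiveOfRecord F N).ν (theta13LiveOfRecord F N).τ9 (EOfRecord₁₃ F N (theta13LiveOfRecord F N)) (wOfRecord₉ F N (theta13LiveOfRecord F N).toStage9Params) (theta13LiveOfRecord F N).ppSel P (gOfRecord₁₃ F N (theta13LiveOfRecord F N) P) (k + 1) s = 0) :
    B16.Thm1Printed (datumOfRecord₁₃SepCoPH F N (gaussPinH (⟨⟨theta13LiveOfRecord F N, Zr⟩, Zh, Phih⟩ : Stage13HParams F N)) hG).C :=
  thm1Printed_datumOfRecord₁₃CoPH_gaussPinH_theta13LiveOfRecordH_of_forall_absent F N hrec hγ habs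

end AbsentRecord

end Summit.QuantumFields.YangMills.Theorems.BalabanUVNodesN11Sect3SupplyChainBorelBZero

end
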